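import Literature.NumberTheory.Automorphic.ClozelAlgebraicity
import Literature.FieldTheory.AlgClosed.AutFixedSubfield
import HarnessLib

/-!
# Clozel's algebraicity fact: reductions for the rationality field and the conjugates (proofs)

Proofs-only companion (theorems, no definitions, no named facts) of `ClozelAlgebraicity.lean`,
whose named fact `Clozel1990_regularAlgebraic` (Clozel 1990, Thm. 3.13 and Lemme 4.9;
Patrikis 2019, Thm. 3.2.1, Cor. 3.2.3) renders `ℚ(π_f)` as `ratField π`, the fixed field in `ℂ`
of the stabiliser `heckeStabilizer π ≤ Aut(ℂ)` of the unramified Hecke eigensystem of `π`.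

What is proved here is the field-theoretic half of clause (i) ("`ℚ(π_f)` is a number field"),
i.e. the step of Clozel's argument that remains once the Hecke eigenvalues are known to lie in a
number field (Clozel 1990, §3.1 and the proof of Thm. 3.13: `π_f` is defined over the number
field `E ⊃ ℚ(π_f)` of rationality of the cuspidal cohomology), and the bookkeeping showing that
the `Aut(ℂ)`-conjugates produced by clause (ii) are again regular algebraic:

* `mem_heckeStabilizer_of_heckeEigenvalue_mem` — if at all but finitely many places the
  unramified Hecke eigenvalues `t_{v,i}` of `π` lie in a subfield `E ⊆ ℂ`, then
  `Aut(ℂ/E) ≤ heckeStabilizer π`;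
* `mem_of_mem_ratField_of_heckeEigenvalue_mem` — hence `ratField π ⊆ E` when `E` is countable:
  the fixed field of `Aut(ℂ/E)` is `E` (`Complex.mem_subfield_of_forall_ringEquiv` of
  `FieldTheory/AlgClosed/AutFixedSubfield`, extension of automorphisms of countable subfields
  of `ℂ`; Lang, *Algebra*, VIII §1);
* `finiteDimensional_ratField_of_heckeEigenvalue_mem` — so `ℚ(π_f) = ratField π` is a number
  field as soon as the eigenvalues at almost all places lie in a subfield of `ℂ` finite over `ℚ`
  (clause (i) of the fact, reduced to the algebraicity-with-bounded-field of the eigenvalues);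
* `Clozel1990_regularAlgebraic.exists_isAutConjugate_isRegularAlgebraic` — under the fact, every
  `σ ∈ Aut(ℂ)` has a cuspidal `σ`-conjugate of `π` at almost all places which is itself regular
  algebraic (its infinity type has the `a`-multisets of `^σT`, which are C-algebraic and regular;
  the `b`-exponents are `a`-exponents at the conjugate embedding by well-formedness).

## References

* L. Clozel, *Motifs et formes automorphes: applications du principe de fonctorialité*, in
  Automorphic forms, Shimura varieties, and L-functions I (Ann Arbor 1988), Academic Press 1990,
  §3.1, Thm. 3.13 [Clozel1990].
* S. Patrikis, *Variations on a theorem of Tate*, Mem. AMS 258 (2019) = arXiv:1207.6724,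
  Thm. 3.2.1 [Patrikis2019].
* S. Lang, *Algebra*, rev. 3rd ed., GTM 211 (2002), Ch. VIII §1 [Lang2002].
-/

noncomputable section

open scoped Classical Cardinal
open NumberField IsDedekindDomain

namespace Literature.NumberTheory.Automorphic

section RatField

variable {n : ℕ} {K : Type} [Field K] [NumberField K] {hcpt : isCompact_glFiniteIntegralLevel n K}

/-- **`Aut(ℂ/E)` stabilises the Hecke eigensystem when the eigenvalues lie in `E`.** If at all
but finitely many finite places `v` every unramified Hecke eigenvalue `t_{v,i}` (`0 ≤ i ≤ n`) of
`π` lies in the subfield `E ⊆ ℂ`, then every `σ ∈ Aut(ℂ)` fixing `E` pointwise belongs to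
`heckeStabilizer π`. (Clozel 1990, §3.1: `^σπ_f ≅ π_f` for `σ ∈ Aut(ℂ/E)` when `π_f` is defined
over `E`.) [cite: Clozel1990, §3.1 and Thm. 3.13] -/
theorem mem_heckeStabilizer_of_heckeEigenvalue_mem
    (π : AutomorphicRepData (AutomorphyDatum.gl n K hcpt)) {E : Subfield ℂ}
    (hE : ∀ᶠ v : HeightOneSpectrum (𝓞 K) in Filter.cofinite, ∀ α : Multiset ℂ,
      π.HasSatakeParamAt v α → ∀ i ≤ n, heckeEigenvalueOf n v α i ∈ E)
    (σ : ℂ ≃ₐ[ℚ] ℂ) (hσ : ∀ x ∈ E, σ x = x) : σ ∈ heckeStabilizer π := by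
  rw [mem_heckeStabilizer_iff]
  filter_upwards [hE] with v hv α hα i hi
  exact hσ _ (hv α hα i hi)

/-- **`ℚ(π_f) ⊆ E` when the eigenvalues lie in a countable subfield `E ⊆ ℂ`.** With the
hypothesis of `mem_heckeStabilizer_of_heckeEigenvalue_mem` and `#E ≤ ℵ₀`, every element of
`ratField π` (the fixed field of `heckeStabilizer π`) lies in `E`: it is fixed by every
automorphism of `ℂ` fixing `E` pointwise (such automorphisms are `ℚ`-algebra automorphisms in the
stabiliser), and the fixed field of `Aut(ℂ/E)` is `E` for countable `E`
(`Complex.mem_subfield_of_forall_ringEquiv`; Lang, *Algebra*, VIII §1). [cite: Lang2002, Ch. VIII §1] -/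
theorem mem_of_mem_ratField_of_heckeEigenvalue_mem
    (π : AutomorphicRepData (AutomorphyDatum.gl n K hcpt)) {E : Subfield ℂ} (hEc : #E ≤ ℵ₀)
    (hE : ∀ᶠ v : HeightOneSpectrum (𝓞 K) in Filter.cofinite, ∀ α : Multiset ℂ,
      π.HasSatakeParamAt v α → ∀ i ≤ n, heckeEigenvalueOf n v α i ∈ E)
    {z : ℂ} (hz : z ∈ ratField π) : z ∈ E := by
  refine Literature.FieldTheory.AlgClosed.Complex.mem_subfield_of_forall_ringEquiv E hEc
    fun σ hσ ↦ ?_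
  -- an automorphism of `ℂ` is a `ℚ`-algebra automorphism
  let σ' : ℂ ≃ₐ[ℚ] ℂ := AlgEquiv.ofRingEquiv (f := σ) fun q ↦ by simp
  have hmem : σ' ∈ heckeStabilizer π :=
    mem_heckeStabilizer_of_heckeEigenvalue_mem π hE σ' fun x hx ↦ hσ x hx
  exact (mem_ratField_iff π z).mp hz σ' hmem

/-- **Clause (i) of Clozel's theorem, reduced to the eigenvalues: `ℚ(π_f)` is a number field as
soon as the unramified Hecke eigenvalues at almost all places lie in a subfield of `ℂ` finite over
`ℚ`.** For such `E` (countable, being algebraic over `ℚ`), `ratField π ⊆ E`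
(`mem_of_mem_ratField_of_heckeEigenvalue_mem`), and a subspace of a finite-dimensional `ℚ`-space
is finite-dimensional. This is the formal step "ℚ(π_f) ⊂ E, `E` a number field" of the proof of
Clozel 1990, Thm. 3.13 (where `E` is the field of rationality of `π_f ⊂ H*_cusp`); the
algebraicity of the eigenvalues themselves is the deep input not proved here. [cite: Clozel1990, Thm. 3.13 (proof, §3.5)] -/
theorem finiteDimensional_ratField_of_heckeEigenvalue_mem
    (π : AutomorphicRepData (AutomorphyDatum.gl n K hcpt)) {E : Subfield ℂ}
    [FiniteDimensional ℚ E]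
    (hE : ∀ᶠ v : HeightOneSpectrum (𝓞 K) in Filter.cofinite, ∀ α : Multiset ℂ,
      π.HasSatakeParamAt v α → ∀ i ≤ n, heckeEigenvalueOf n v α i ∈ E) :
    FiniteDimensional ℚ (ratField π) := by
  haveI : Algebra.IsAlgebraic ℚ E := Algebra.IsAlgebraic.of_finite ℚ E
  have hEc : #E ≤ ℵ₀ :=
    Literature.FieldTheory.AlgClosed.Subfield.cardinalMk_le_aleph0_of_isAlgebraic E
  have hle : ∀ z ∈ ratField π, z ∈ E := fun z hz ↦
    mem_of_mem_ratField_of_heckeEigenvalue_mem π hEc hE hz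
  -- the inclusion `ratField π ↪ E` as an injective `ℚ`-linear map
  let f : ratField π →ₗ[ℚ] E :=
    { toFun := fun z ↦ ⟨z, hle z z.2⟩
      map_add' := fun _ _ ↦ rfl
      map_smul' := fun q z ↦ Subtype.ext (by simp) }
  exact Module.Finite.of_injective f fun a b h ↦ Subtype.ext (congrArg Subtype.val h :)

end RatField

section Conjugates

variable {n : ℕ} {K : Type} [Field K] [NumberField K] {hcpt : isCompact_glFiniteIntegralLevel n K}

omit [NumberField K] in
/-- **An infinity type with the `a`-multisets of a conjugate `^σT` of a regular algebraic `T` is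
regular algebraic.** If `T` is regular algebraic, `T'` is well formed and
`{a-multiset of T' at ι} = {a-multiset of ^σT at ι}` for all `ι`, then `T'` is regular algebraic:
its `a`-exponents are `a`-exponents of `T` (at `σ⁻¹ι`), its `b`-exponents are `a`-exponents of
`T'` at `ῑ` (well-formedness), and regularity only reads the `a`-multisets.
(Clozel 1990, Thm. 3.13: `^σπ` is again regular algebraic.) [cite: Clozel1990, Thm. 3.13] -/
theorem InfinityType.isRegularAlgebraic_of_map_a_eq_autConj {T T' : InfinityType K n}
    (hreg : T.IsRegularAlgebraic) (hwf : T'.IsWellFormed) (σ : ℂ ≃ₐ[ℚ] ℂ)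
    (ha : ∀ ι : K →+* ℂ, (T' ι).map ArchWeight.a = (T.autConj σ ι).map ArchWeight.a) :
    T'.IsRegularAlgebraic := by
  refine ⟨fun ι p hp ↦ ?_, fun ι ↦ ?_⟩
  · -- the `a`-exponent of `p` is an `a`-exponent of `T` at `σ⁻¹ ι`
    have hpa : p.a ∈ (T.autConj σ ι).map ArchWeight.a := by
      rw [← ha ι]
      exact Multiset.mem_map_of_mem _ hp
    obtain ⟨p₀, hp₀, hp₀a⟩ := Multiset.mem_map.mp hpa
    obtain ⟨k, -, hk, -⟩ := hreg.1 _ p₀ hp₀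
    -- the `b`-exponent of `p` is the `a`-exponent of `swap p ∈ T' ῑ`
    have hpb : p.b ∈ (T.autConj σ (ComplexEmbedding.conjugate ι)).map ArchWeight.a := by
      rw [← ha, hwf.2 ι, Multiset.map_map]
      exact Multiset.mem_map.mpr ⟨p, hp, rfl⟩
    obtain ⟨p₁, hp₁, hp₁a⟩ := Multiset.mem_map.mp hpb
    obtain ⟨l, -, hl, -⟩ := hreg.1 _ p₁ hp₁
    exact ⟨k, l, by rw [← hp₀a]; exact hk, by rw [← hp₁a]; exact hl⟩
  · rw [ha ι]
    exact hreg.2 _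

/-- **Under the fact, the `Aut(ℂ)`-conjugates are regular algebraic.** For a cuspidal regular
algebraic `π` and `σ ∈ Aut(ℂ)`, clause (ii) of `Clozel1990_regularAlgebraic` provides a cuspidal
`π'`, `σ`-conjugate to `π` at almost all places, with an infinity type having the `a`-multisets of
`^σT`; by `InfinityType.isRegularAlgebraic_of_map_a_eq_autConj` that infinity type is regular
algebraic, so `π'` is regular algebraic (Clozel 1990, Thm. 3.13: "`^σπ` … de type `^σ(p, q)`",
again algebraic regular). [cite: Clozel1990, Thm. 3.13] -/
theorem Clozel1990_regularAlgebraic.exists_isAutConjugate_isRegularAlgebraic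
    (h : Clozel1990_regularAlgebraic) (π : CuspidalAutomorphicRepData n K hcpt)
    (hπ : π.1.IsRegularAlgebraic) (σ : ℂ ≃ₐ[ℚ] ℂ) :
    ∃ π' : CuspidalAutomorphicRepData n K hcpt,
      IsAutConjugate σ π.1 π'.1 ∧ π'.1.IsRegularAlgebraic := by
  obtain ⟨T, hT, hreg⟩ := hπ
  obtain ⟨π', hc, hT'⟩ := h.exists_autConjugate π ⟨T, hT, hreg⟩ σ
  obtain ⟨T', hT'π, ha⟩ := hT' T hT hreg
  exact ⟨π', hc, T', hT'π, InfinityType.isRegularAlgebraic_of_map_a_eq_autConj hreg hT'π.1 σ ha⟩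

end Conjugates

end Literature.NumberTheory.Automorphic
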